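import Mathlib
import HarnessLib
import HarnessLib.Audit
import Summits.ValiantsHypothesis.Statement
import Literature.Computability.AlgebraicComplexity.OrbitClosure
import Literature.Computability.AlgebraicComplexity.LinSubst
import HarnessLib.Audit.Status.Attr

/-!
Route: UnpaddedGIT

DORMANT since 2026-08-22T06:29:31Z (reconciler: no traction for 5.1 d (last activity item-evidence-added at 2026-08-17T02:39:29Z); parked, not closed — `ledger route dormant route-ValiantsHypothesis-UnpaddedGIT --off` to reactivate) — unstaffed, not closed; items shared with open routes are served there. `ledger route dormant <id> --off` reactivates.

# Route UnpaddedGIT — same-space GIT — an SL(n²)-invariant kills every pencil coefficient of size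
qp(n) but not per_n

It suffices to show X = INVARIANT SEPARATION IN THE PERMANENT'S OWN SPACE (card
unpadded-git-polystable-per): for every c
there is n₀ such that for all n ≥ n₀ and all m ≤ 2^((log₂ n + c)^c) there is a polynomial F in the
coefficients of degree-n
forms in the n² variables x_ij which is SL_{n²}-invariant (under linear substitution), vanishes on
the PENCIL-COEFFICIENT FAMILY
D_m(n) := { degree-n homogeneous component of det A : A an m×m matrix of affine-linear forms in the
x_ij } (the coefficient of
ℓ^(m−n) in det(ℓ·A₀ + A₁(x)); it contains every degree-n form of determinantal complexity ≤ m and is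
a GL_{n²}-stable cone inside
Sym^n ℂ^(n²)), and does not vanish at per_n. No padding, no larger group: all sizes m live in
per_n's own space. Because per_n is
polystable (BurgisserIkenmeyer2017 Cor. 2.9) and the Zariski closure of D_m is a closed SL-stable
cone, Mumford's separation of
disjoint closed invariant sets says such an F EXISTS IFF per_n ∉ closure(D_m) — obstructions exist
iff the separation is true
(support item Completeness); the forward direction X ⇒ dc(per_n) not quasi-polynomially bounded ⇒ VP
≠ VNP is elementary.
Lean: `∀ c : ℕ, ∃ n₀ : ℕ, ∀ n ≥ n₀, ∀ m : ℕ, m ≤ 2 ^ ((Nat.log 2 n + c) ^ c) → ∃ F : MvPolynomial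
((Fin n × Fin n) →₀ ℕ) ℂ, (∀ (g : Matrix.SpecialLinearGroup (Fin n × Fin n) ℂ) (f : MvPolynomial
(Fin n × Fin n) ℂ), f.IsHomogeneous n → MvPolynomial.aeval
(Literature.Computability.AlgebraicComplexity.coeffVec
(Literature.Computability.AlgebraicComplexity.linSubst (Fin n × Fin n) ℂ (g : Matrix (Fin n × Fin n)
(Fin n × Fin n) ℂ) f)) F = MvPolynomial.aeval (Literature.Computability.AlgebraicComplexity.coeffVec
f) F) ∧ (∀ A : Matrix (Fin m) (Fin m) (MvPolynomial (Fin n × Fin n) ℂ), (∀ i j, (A i j).totalDegree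
≤ 1) → MvPolynomial.aeval (Literature.Computability.AlgebraicComplexity.coeffVec
(MvPolynomial.homogeneousComponent n A.det)) F = 0) ∧ MvPolynomial.aeval
(Literature.Computability.AlgebraicComplexity.coeffVec
(Literature.Computability.AlgebraicComplexity.perPoly (Fin n) ℂ)) F ≠ 0`

## Assembly
Pure bookkeeping, PROVED sorry-free in the planner's folder (AssemblyProof.lean, 15 lines, lean
check rc 0): if per were a VP
family then dc(per_n) would be qp-bounded (tree fact
isQPBounded_determinantalComplexity_of_isVPFamily_holds) with some constant c;
take n₀ from X at c, m := dc(per_(n₀)) ≤ 2^((log₂ n₀ + c)^c), an affine A with det A = per_(n₀)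
(hasDetRepr_determinantalComplexity_holds);
then hc_(n₀)(det A) = per_(n₀) ∈ D_m, so F(per_(n₀)) = 0, contradiction; hence ¬IsVPFamily per, and
the hub lemma
(Theorems/HubHub.lean with mem_VP_ofFintype_iff_holds, perFamily_mem_VNP_holds) gives VP ℂ ≠ VNP ℂ.
The cruxes 2–4 are the
milestone ladder below X (qp ⇒ poly ⇒ n+1 ⇒ n with degree control), not extra hypotheses of the
assembly.

Rationale: WHY THIS LINE. Padded GCT compares ℓ^(m−n)per_n with det_m inside Sym^m ℂ^(m²), where the padded
permanent is unstable and occurrence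
obstructions provably die (BurgisserIkenmeyerPanova2019; barrier GCTOccurrenceObstructions); the
homogeneous models of
GesmundoIkenmeyerPanova2017 / arXiv:1610.00159 Rem. 4.3 remove the padding but embed per_n into more
variables, where it is again
unstable. Here the universal object is moved instead: the pencil coefficients hc_n det(A₀ + A₁(x))
of all sizes m form one
GL_{n²}-stable cone D_m(n) ⊂ Sym^n ℂ^(n²) ({dc ≤ m} ⊆ D_m ⊆ {dc ≤ poly(m)}; for invertible A₀ it is
det(A₀)·e_n(A₀⁻¹A₁(x)), so
closure(D_m) = closure{e_n of an m×m matrix pencil}, containing Shpilka's symmetric depth-2 model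
(Shpilka2002, Landsberg2017
§7.4.2), homogeneous ABPs/IMM and closure(D_n) = GL_{n²}·det_n-bar), and per_n stays POLYSTABLE in
its own space, so by geometric
invariant theory (MumfordFogartyKirwan1994 Ch. 1 §2, DerksenKemper2015 §2.3–2.4) the trivial
isotypic type alone — the invariant
ring ℂ[Sym^n ℂ^(n²)]^SL — is COMPLETE for the separation. Imported areas: GIT/classical invariant
theory (polystability,
Reynolds separation, Weyl1939 first fundamental theorem: pulled back along A₁ an invariant becomes a
GL_m-conjugation-invariant
polynomial in the Plücker coordinates of Gr(n², m²)), and the combinatorics of tableau invariants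
(BurgisserIkenmeyer2017 §3:
evaluations at per_n/det_n are signed Latin-square-type counts, Prop. 3.28; Kumar2015). What it does
that DetQP/GCTMult do not:
the target is typed in per_n's own coefficient space with no orbit closure of det_m and no
multiplicities; GCTMult's thesis at
the same m follows from it (support PaddedToPencil). Dictionary to padded GCT, stated honestly:
composing F with coefficient
extraction [ℓ^(m−n)] gives an equation of Det_m non-vanishing at the padded permanent of
GL_(n²+1)-type (d(m−n)+k−j, k^(n²−1), j)
— so the line is "separating modules of near-rectangular shape", which Mumford makes complete;
negatives index empty.

RANKED CRUXES. #0 InvariantSeparationQP (target) — X as in § Thesis: for every c, eventually in n,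
for every m ≤ 2^((log₂ n + c)^c) some SL_{n²}-invariant polynomial on degree-n forms vanishes on the
pencil-coefficient family D_m(n) and not at per_n (card unpadded-git-polystable-per, thesis). (why
it might fail: equivalent (Mumford + BI17 Cor 2.9) to per_n ∉ closure(D_m), m ≤ qp(n), which implies
border-dc(per_n) not qp-bounded (border Extended VH = GCTMult's target): false if per_n is a limit
of qp-size pencil coefficients; records are only n²/2 ≤ border-dc, dc ≤ 2^n − 1.)
[BurgisserIkenmeyer2017, MumfordFogartyKirwan1994, BurgisserClausenShokrollahi1997, arXiv:1004.4802,
Grenet2011, Grochow2015]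
#2 InvariantSeparationPoly (crux) — the polynomial window of X: for every c, for all large n, some
SL_{n²}-invariant polynomial on degree-n forms vanishes on D_(n^c)(n) and not at per_n (card item
"crux A" at MS strength; by monotonicity D_m ⊆ D_(m+1) it is implied by the target and is its
necessary milestone). [difficulty: open-problem] (why it might fail: equivalent (given Completeness)
to per_n ∉ closure(D_(n^c)) for all c, so it implies border-dc(per_n) superpolynomial
(Mulmuley–Sohoni strength, open); nothing excludes per_n ∈ closure(D_(n^3)); the invariants one can
write (tableau sums, BI17 §3) have Alon–Tarsi-type signed values at per_n.) [MulmuleySohoni2001,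
BurgisserIkenmeyer2017, arXiv:1004.4802, GesmundoIkenmeyerPanova2017, arXiv:1610.00159]
#3 PerNotInPencilNPlusOne (crux) — first open rung, geometric form: for all large n, per_n is not in
the Zariski closure of D_(n+1)(n); concretely (rank normal form of A₀) D_(n+1)(n) = { Σ_(a ≤ r) det
L^(aa)(x) : r ≤ n+1, L an (n+1)×(n+1) matrix of linear forms, L^(aa) = delete row and column a }, so
the claim is that per_n is not a limit of sums of co-principal n-minors of one (n+1)×(n+1) linear
matrix. (m = n is known: closure(D_n) = GL·det_n-bar ∌ per_n by border-dc ≥ n²/2.) [difficulty: L]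
(why it might fail: small n fail: per_3 = det L₁ + det L₂ (product rank 4, IltenTeitler2016); no
known technique reaches m = n+1: flattening ranks of per_n and of one n-minor agree,
Hessian-rank/dual-degeneracy arguments (MR04, LMR13) die since e_n-pencils have generic Hessian
(arXiv:1610.00159 Rem 4.3).) [IltenTeitler2016, MignonRessayre2004, arXiv:1004.4802,
arXiv:1610.00159, AlperBogartVelasco2017, Landsberg2017]
#4 PolyDegreeSeparationFromDet (crux) — bottom rung with degree control (the mechanism's first
test): there are c and n₀ such that for n ≥ n₀ an SL_{n²}-invariant F of total degree ≤ n^c vanishes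
on D_n(n) = End·det_n (equivalently F(det_n) = 0 for homogeneous F) but F(per_n) ≠ 0. Existence
without the degree bound follows from GIT (per_n ∉ GL·det_n-bar, both polystable); the content is
that tableau invariants P_T of polynomial degree already separate, i.e. the signed admissible-table
counts P_T(per_n), P_T(det_n) (BI17 Prop 3.28-type) can be controlled. [difficulty: L] (why it might
fail: no invariant below degree n² (Howe; BI17 Thm 3.14); the degree-n² invariant is nonzero at BOTH
per_4 and det_4 (BI17 §3.3), and its nonvanishing at per_n is an open Alon–Tarsi-type problem;
generic separating-degree bounds (Derksen) are exponential in dim SL_(n²).) [BurgisserIkenmeyer2017,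
Kumar2015, BurgisserHuttenhainIkenmeyer2017, Glynn2010, DerksenKemper2015]
#9 PaddedToPencil (support) — model comparison (links X to route GCTMult): if the padded permanent
X₀₀^(m−n)per_n lies in the orbit closure of det_m (HasBorderDetRepr, n ≤ m) then per_n lies in the
Zariski closure of D_m(n) — restrict det_m(g·X) to the n²+1 variables, set X₀₀ = 1, take the
degree-n component (a linear, hence Zariski-continuous, map on degree-m coefficient vectors). Hence
X at (n, m) ⇒ GCTMult.GctThesis at (n, m). [difficulty: M] [MulmuleySohoni2001,
BurgisserIkenmeyerPanova2019, Landsberg2017]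
#9 GrenetPencil (support) — junk guard (upper side): per_n ∈ D_(2^n − 1)(n) for n ≥ 1, from Grenet's
dc(per_n) ≤ 2^n − 1 (tree: determinantalComplexity_perPoly_le_holds,
hasDetRepr_determinantalComplexity_holds, HasDetRepr.mono_holds) and hc_n(per_n) = per_n; shows the
target is not junk-true at exponential m. [difficulty: provable-now] [Grenet2011,
Literature.Computability.AlgebraicComplexity.determinantalComplexity_perPoly_le_holds]
#9 QuadricSanity (support) — junk guard (lower side, satisfiability of the encoding): for n = 2, m =
1 (D_1(2) = {0}) the discriminant of quaternary quadratic forms is an SL_4-invariant polynomial in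
the coefficients, vanishes at 0 and not at the full-rank quadric per_2 = x₀₀x₁₁ + x₀₁x₁₀ (BI17 Rem
3.27). [difficulty: provable-now] [BurgisserIkenmeyer2017, Weyl1939]
#9 Completeness (support) — obstructions exist iff the separation holds: with (i) polystability of
per_n (the SL_{n²}-orbit of per_n is Zariski closed in coefficient space; BI17 Cor 2.9) and (ii)
Mumford separation for SL_{n²} acting on degree-n forms (disjoint Zariski-closed SL-stable subsets
are separated by an invariant taking values 0 and 1) both INLINED AS HYPOTHESES (they are requested
as Literature cite facts), per_n ∉ Zariski-closure(D_m(n)) implies the existence of the invariant F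
of the target at (n, m). What remains is bookkeeping: D_m is SL-stable (linear substitution keeps
entries affine and commutes with det and with homogeneous components), closures of stable sets are
stable, the orbit is disjoint from the closure. [difficulty: M] [MumfordFogartyKirwan1994,
BurgisserIkenmeyer2017, DerksenKemper2015, KempfNess1979]

TWO-LAYER PLAN. Foreseen glued splits (none filed now): PerNotInPencilNPlusOne ⇐
InvariantSeparationNPlusOne (the invariant form at m = n+1:
an SL-invariant killing all Σ_(a≤r) det L^(aa)(x), nonzero at per_n) → trivial glue;
InvariantSeparationPoly ⇐ PluckerKernel
(via Weyl's FFT the pull-back F ↦ (A₁ ↦ F(e_n(A₁(x)))) lands in the GL_m-conjugation invariants of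
the degree-d/n Plücker algebra
of Gr(n², m²), of dimension Σ_μ g((d/n)^(n²), μ, μ); crux = a degree d(n) with an invariant nonzero
at per_n in the kernel) →
glue by the normal form closure(D_m) = closure{det(A₀)e_n(A₀⁻¹A₁x)}; PolyDegreeSeparationFromDet ⇐
TableauPair (a tableau family
T(n) of degree ≤ n^c with P_T(per_n) ≠ 0 = P_T(det_n), evaluated by BI17 (3.1) as signed
admissible-table counts) → glue
"F(det_n) = 0 ⇒ F vanishes on End·det_n" (homogeneity + continuity).

KILL CRITERIA. A proof that per_n ∈ Zariski-closure(D_(n^c)(n)) for some c and all large n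
(polynomial border pencil size; it also sinks
GCTMult's thesis) refutes InvariantSeparationPoly and the target: close
`refuted:InvariantSeparationPoly`. A uniform identity
per_n = lim Σ_(a≤r) det L^(aa)(x) with (n+1)×(n+1) pencils refutes PerNotInPencilNPlusOne and
everything above it: close. A theorem
"every SL_(n²)-invariant of degree ≤ 2^(n^δ) vanishing at det_n vanishes at per_n" refutes
PolyDegreeSeparationFromDet and kills
the explicit (tableau) programme — pivot to pure-existence use of Completeness or close as
exhausted. DetQP.DetqpThesis or
GCTMult.GctThesis proved elsewhere moots the route (same consequence chain); border-dc(per_n) ≤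
2^polylog proved elsewhere refutes it.

NOT DECOMPOSED YET. The ℂ[S_n]-weight-slice sub-problem of the card (which Σ c_σ x^σ lie in
closure(D_qp)) — no precise statement yet, next to the
immanant dichotomies; symmetric/equivariant pencils à la LandsbergRessayre2017 (an exponential lower
bound for Γ_per-equivariant
pencil representations is plausible by the tree's LR machinery but is a side regime); the
FFT/Plücker layer (Weyl1939 FFT for
SL_N is not in Mathlib — Literature work before PluckerKernel can be typed); degree-monoid
("occurrence-type") obstructions
E(per_n) ⊄ E(closure D_m) are NOT pursued: by BI17 Thm 3.4 the degree monoids of det_n and per_n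
generate nℤ·a and are cofinite in
it, so such obstructions can only live in finitely many small degrees where no invariant vanishes at
det_4 (BI17 §3.3); n = 3, 4
profiles (least m with per_n ∈ D_m(n), resp. its closure) are kit experiments, deliberately not
items (a refuted small-n guess
would break the route for nothing).

CHEAPEST FALSIFIER. Numerical membership for n = 3: solve hc_3 det(J_r + L(x)) = per_3 (L a 4×4,
then 5×5, 6×6 matrix of linear forms in 9
variables; 144–324 unknowns, 165 cubic equations; homotopy continuation / random restriction +
Newton) and the same for per_4
versus D_5(4). per_3 ∈ D_7 is known (dc(per_3) = 7, AlperBogartVelasco2017) and per_3 is a sum of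
two 3×3 determinants of linear
forms (product rank 4), so per_3 ∈ closure(D_4) would not be alarming by itself; per_4 ∈
closure(D_5(4)) together with it would
make PerNotInPencilNPlusOne (n₀-asymptotic) suspect and demote the rung to m = n + O(1). Not run
here (hub is compute-free for this
seat; file as a kit job by the first refuter). Lookup falsifier for rank 4: is E(per_n) ⊆ E(det_n)
in all degrees ≤ n³ for n = 4
(plethysm (k^16) ⊂ Sym^(4k)(Sym^4 ℂ^16), k = 4..16, tableau evaluations by BI17 (3.1))? If every
invariant of degree ≤ 64 that is
nonzero at per_4 is nonzero at det_4, the polynomial-degree hope has no small witness.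

NUMBERS. dc(per_n) ≥ n²/2 (MignonRessayre2004 Thm 1.1); border-dc(per_n) ≥ n²/2 (arXiv:1004.4802 Thm
1.0.1); dc(per_3) = 7
(AlperBogartVelasco2017); dc(per_n) ≤ 2^n − 1 (Grenet2011, tree:
determinantalComplexity_perPoly_le_holds) hence per_n ∈
D_(2^n−1)(n); product (Chow) rank of per_3 = 4, of det_3 = 5 (IltenTeitler2016) so per_3 = det L₁ +
det L₂ with 3×3 linear L_i;
esc(det_m) ≥ 2m² − 3m for Shpilka's diagonal-pencil model (Shpilka2002; Landsberg2017 Ex. 7.4.2.6);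
SL_(n²)-invariants of degree-n
forms in n² variables: none of degree < n², exactly one (P_(n,n²), n even) in degree n² (Howe;
BurgisserIkenmeyer2017 Thm 3.14/3.15);
e(per_n) ≥ n² with equality iff #column-even ≠ #column-odd admissible n-tables (BI17 Prop 3.28);
P_(4,16)(per_4) ≠ 0 and
P_(4,16)(det_4) ≠ 0 (BI17 §3.3, computer); Alon–Tarsi holds for n = p ± 1 (Glynn2010); occurrence
obstructions impossible for
m ≥ n^25 in the padded model (BurgisserIkenmeyerPanova2019) — not used here. Items at open: 9 (1
target, 3 cruxes, 4 support, 1 assembly).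

DEFINITION REQUESTS. Cite facts wanted (hypotheses of Completeness, to be re-filed as `(h : Fact) →`
once they land): (1) BurgisserIkenmeyer2017 Cor. 2.9:
per_n and det_n are polystable — the SL_(n²)-orbit (linSubst over Matrix.SpecialLinearGroup) of
perPoly (Fin n) ℂ has Zariski-closed
image under coeffVec; (2) Mumford separation (MumfordFogartyKirwan1994 Ch. 1 §2, Cor. 1.2;
DerksenKemper2015 §2.3): for SL_N(ℂ) acting
rationally on a finite-dimensional space, disjoint Zariski-closed invariant subsets are separated by
an invariant polynomial;
(3) Weyl1939 first fundamental theorem for SL_N (invariants of N×M matrices under SL_N = Plücker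
algebra), needed before the layer-2
PluckerKernel statement can be typed. Definitions (convenience, statements are already inlined):
`pencilFamily n m : Set (MvPolynomial
(Fin n × Fin n) ℂ)` (= D_m(n)) and `IsSLInvariantOnForms n F` under
Summits/ValiantsHypothesis/ValiantsHypothesis/Theorems.

Novelty: Searches (2026-08-15): `lit search --hybrid "separating invariants permanent determinant orbit
closure same space polystable"` (12 local
docs; relevant: Landsberg2017 only), `lit search --hybrid "permanent determinant principal minors
linear forms representation"` (12;
Landsberg2017 §7.4.2 = Shpilka's esc model found this way), `lit search --source zbmath "permanent
sum of determinants"` (15, none relevant),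
`"sum of determinants" complexity` (zbmath 1, irrelevant), `lit frontier ValiantsHypothesis --since
2020` (30 rows; read arXiv:2604.28019 —
non-commutative symmetrized det, unrelated), `lit bridges ValiantsHypothesis --cross any`, `lit
read` of arXiv:1511.02927 (pp. 3, 6–8, 10,
13–14), arXiv:1304.6333 (grep: no polystable/closed-orbit/invariant-ring use), arXiv:1610.00159 (Thm
4.1, Rem 4.3), Landsberg2017 pp.
195–199; galaxy search saturated (queued > 90 s, twice) and OpenAlex/S2/arXiv APIs rate-limited
during the session — recorded, not retried
further; the card's own audit (refuter-novelty-audit-…-5-0) had already run lit --hybrid ×2, zbmath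
×2, crossref ×2, galaxy ×2.
Nearest prior art found: BurgisserIkenmeyer2017 (arXiv:1511.02927) — polystability of per_n/det_n,
fundamental invariants, same-space
use of an SL-invariant as a non-membership certificate for ORBIT CLOSURES (F_n at the unit tensor),
evaluations as Latin-square counts;
Grochow2015 (arXiv:1304.6333) — same-space separating modules for fixed-format classes, no
restriction to invariants; GesmundoIkenmeyerPan  [refs: 2604.28019, 1511.02927, 1304.6333, 1610.00159, Landsberg2017, BurgisserIkenmeyer2017, Grochow2015, GesmundoIkenmeyerPanova2017, Shpilka2002]

Barriers (technique_class: gct, invariant-separation, same-space-equations): - technique_class: gct, invariant-separation, same-space-equations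
- Literature.Barriers.ValiantsHypothesis.GCTOccurrenceObstructions: does not apply — no padding, no
GL_(m²), no occurrence comparison; through the dictionary F∘[ℓ^(m−n)] the route produces separating
EQUATIONS of Det_m of near-rectangular type nonvanishing at the padded permanent, whose existence
for some type is equivalent to non-membership and is untouched by BIP's theorem (which kills
non-occurrence, m ≥ n^25).
- Literature.Barriers.ValiantsHypothesis.GCTUsefulModules: consistent, not evaded: translated
modules have first row ≥ d(m−n) automatically (Pieri branching of (k^(n²)) ⊗ ℓ-weight d(m−n)),
exactly Kadish–Landsberg's constraint; it costs nothing here because evaluation happens at the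
polystable per_n in the small space, not at the padded point.
- Literature.Barriers.ValiantsHypothesis.NotViaSaturations: applies in spirit and is conceded:
per_n, det_n and generic pencil coefficients are all polystable, so no instability / moment-polytope
/ saturation argument separates them; F must be a genuine element of the ideal of closure(D_m). The
bet is that ideal membership is testable on the parametrised family (a polynomial identity in (A₀,
A₁), by FFT an identity in Plücker coordinates) where occurrence in a coordinate ring was not.
- Literature.Barriers.ValiantsHypothesis.GCTMatrixPowering: the route lives in the same homogeneous
(unpadded) setting — restricting e_n / tr(X^n) / det-pencils to n² variables is

Novelty grade: new-combination — ROUTE REVIEW (refuter, 2026-08-15): KEEP OPEN; no blocking objection. All 9 decls elaborate rc0; Literature defs (coeffVec, linSubst, zariskiClosure=Z(I(S)), HasBorderDetRepr, IsQPBounded) read and non-junk for this use. Findings: (1) Target X is, via Completeness (whose two inlined hypotheses — BI1 (refuter refuter-rreview-route-ValiantsHypothesis-4aa92cbb-0, 2026-08-15T14:05:49Z; prior: BurgisserIkenmeyer2017 arXiv:1511.02927 (polystability of per_n/det_n; SL-invariants in the form's own space as non-membership certificates), MumfordFogartyKirwan1994 Cor 1.2 (separation of closed invariant sets), Grochow2015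 arXiv:1304.6333 (same-space separating modules), GesmundoIkenmeyerPanova2017 / arXiv:1610.00159 (homogeneous unpadded models), MignonRessayre2004, LandsbergManivelRessayre ar)

History (route lifecycle, newest last):
- 2026-08-16T04:22:20Z · AUTO-CRUX (backfill): InvariantSeparationQP — hypotheses of the deciding theorem that nothing in the route derives are cruxes (operator:999:1085951)
- 2026-08-22T06:29:31Z · DORMANT — reconciler: no traction for 5.1 d (last activity item-evidence-added at 2026-08-17T02:39:29Z); parked, not closed — `ledger route dormant route-ValiantsHypothes (operator:999:3017390)

sub-problem: ValiantsHypothesis · status: dormant · opened planner-plancard-ValiantsHypothesis-ValiantsH-42fa148a-0 2026-08-15T11:42:23Z · rev 2 · ledger route-ValiantsHypothesis-UnpaddedGIT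
GENERATED by the gate from the ledger (D-0016/17). Provers cite these decls: `theorem foo : Summit.ValiantsHypothesis.ValiantsHypothesis.Theses.UnpaddedGIT.<Decl> := …` in Summits/ValiantsHypothesis/ValiantsHypothesis/Theorems/<Name>.lean.
-/

namespace Summit.ValiantsHypothesis.ValiantsHypothesis.Theses.UnpaddedGIT

open scoped BigOperators Topology Manifold Classical MeasureTheory ProbabilityTheory Matrix InnerProductSpace ComplexConjugate ContinuousMap
open Filter Set Function TopologicalSpace MeasureTheory

attribute [summit_statement] _root_.ValiantsHypothesis

open Literature.PNP

/-- item stmt-ValiantsHypothesis-5758 · crux (kind.auto-crux: conjecture-grade) · rank 0 · open · by planner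
why it might fail: equivalent (Mumford + BI17 Cor 2.9) to per_n ∉ closure(D_m), m ≤ qp(n), which implies border-dc(per_n) not qp-bounded (border Extended VH = GCTMult's target): false if per_n is a limit of qp-size pencil coefficients; records are only n²/2 ≤ border-dc, dc ≤ 2^n − 1.
sources: BurgisserIkenmeyer2017, MumfordFogartyKirwan1994, BurgisserClausenShokrollahi1997, arXiv:1004.4802, Grenet2011, Grochow2015
[target] X as in § Thesis: for every c, eventually in n, for every m ≤ 2^((log₂ n + c)^c) some
SL_{n²}-invariant polynomial on degree-n forms vanishes on the pencil-coefficient family D_m(n) and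
not at per_n (card unpadded-git-polystable-per, thesis). -/
@[route_item "route-ValiantsHypothesis-UnpaddedGIT", crux]
def InvariantSeparationQP : Prop :=
  ∀ c : ℕ, ∃ n₀ : ℕ, ∀ n ≥ n₀, ∀ m : ℕ, m ≤ 2 ^ ((Nat.log 2 n + c) ^ c) → ∃ F : MvPolynomial ((Fin n × Fin n) →₀ ℕ) ℂ, (∀ (g : Matrix.SpecialLinearGroup (Fin n × Fin n) ℂ) (f : MvPolynomial (Fin n × Fin n) ℂ), f.IsHomogeneous n → MvPolynomial.aeval (Literature.Computability.AlgebraicComplexity.coeffVec (Literature.Computability.AlgebraicComplexity.linSubst (Fin n × Fin n) ℂ (g : Matrix (Fin n × Fin n) (Fin n × Fin n) ℂ) f)) F = MvPolynomial.aeval (Literature.Computability.AlgebraicComplexity.coeffVec f) F) ∧ (∀ A : Matrix (Fin m) (Fin m) (MvPolynomial (Fin n × Fin n) ℂ), (∀ i j, (A i j).totalDegree ≤ 1) → MvPolynomial.aeval (Literature.Computability.AlgebraicComplexity.coeffVec (MvPolynomial.homogeneousComponent n A.det)) F = 0) ∧ MvPolynomial.aeval (Literature.Computability.AlgebraicComplexity.coeffVec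 (Literature.Computability.AlgebraicComplexity.perPoly (Fin n) ℂ)) F ≠ 0

/-- item stmt-ValiantsHypothesis-5759 · crux · rank 2 · open · by planner
why it might fail: equivalent (given Completeness) to per_n ∉ closure(D_(n^c)) for all c, so it implies border-dc(per_n) superpolynomial (Mulmuley–Sohoni strength, open); nothing excludes per_n ∈ closure(D_(n^3)); the invariants one can write (tableau sums, BI17 §3) have Alon–Tarsi-type signed values at per_n.
sources: MulmuleySohoni2001, BurgisserIkenmeyer2017, arXiv:1004.4802, GesmundoIkenmeyerPanova2017, arXiv:1610.00159
[crux] the polynomial window of X: for every c, for all large n, some SL_{n²}-invariant polynomial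
on degree-n forms vanishes on D_(n^c)(n) and not at per_n (card item "crux A" at MS strength; by
monotonicity D_m ⊆ D_(m+1) it is implied by the target and is its necessary milestone). [difficulty:
open-problem] -/
@[route_item "route-ValiantsHypothesis-UnpaddedGIT", crux]
def InvariantSeparationPoly : Prop :=
  ∀ c : ℕ, ∃ n₀ : ℕ, ∀ n ≥ n₀, ∃ F : MvPolynomial ((Fin n × Fin n) →₀ ℕ) ℂ, (∀ (g : Matrix.SpecialLinearGroup (Fin n × Fin n) ℂ) (f : MvPolynomial (Fin n × Fin n) ℂ), f.IsHomogeneous n → MvPolynomial.aeval (Literature.Computability.AlgebraicComplexity.coeffVec (Literature.Computability.AlgebraicComplexity.linSubst (Fin n × Fin n) ℂ (g : Matrix (Fin n × Fin n) (Fin n × Fin n) ℂ) f)) F = MvPolynomial.aeval (Literature.Computability.AlgebraicComplexity.coeffVec f) F) ∧ (∀ A : Matrix (Fin (n ^ c)) (Fin (n ^ c)) (MvPolynomial (Fin n × Fin n) ℂ), (∀ i j, (A i j).totalDegree ≤ 1) → MvPolynomial.aeval (Literature.Computability.AlgebraicComplexity.coeffVec (MvPolynomial.homogeneousComponent n A.det))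 F = 0) ∧ MvPolynomial.aeval (Literature.Computability.AlgebraicComplexity.coeffVec (Literature.Computability.AlgebraicComplexity.perPoly (Fin n) ℂ)) F ≠ 0

/-- item stmt-ValiantsHypothesis-5760 · crux · rank 3 · open · by planner
why it might fail: small n fail: per_3 = det L₁ + det L₂ (product rank 4, IltenTeitler2016); no known technique reaches m = n+1: flattening ranks of per_n and of one n-minor agree, Hessian-rank/dual-degeneracy arguments (MR04, LMR13) die since e_n-pencils have generic Hessian (arXiv:1610.00159 Rem 4.3).
sources: IltenTeitler2016, MignonRessayre2004, arXiv:1004.4802, arXiv:1610.00159, AlperBogartVelasco2017, Landsberg2017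
[crux] first open rung, geometric form: for all large n, per_n is not in the Zariski closure of
D_(n+1)(n); concretely (rank normal form of A₀) D_(n+1)(n) = { Σ_(a ≤ r) det L^(aa)(x) : r ≤ n+1, L
an (n+1)×(n+1) matrix of linear forms, L^(aa) = delete row and column a }, so the claim is that
per_n is not a limit of sums of co-principal n-minors of one (n+1)×(n+1) linear matrix. (m = n is
known: closure(D_n) = GL·det_n-bar ∌ per_n by border-dc ≥ n²/2.) [difficulty: L] -/
@[route_item "route-ValiantsHypothesis-UnpaddedGIT", crux]
def PerNotInPencilNPlusOne : Prop :=
  ∃ n₀ : ℕ, ∀ n ≥ n₀, Literature.Computability.AlgebraicComplexity.coeffVec (Literature.Computability.AlgebraicComplexity.perPoly (Fin n) ℂ) ∉ Literature.Computability.AlgebraicComplexity.zariskiClosure (Literature.Computability.AlgebraicComplexity.coeffVec '' {g : MvPolynomial (Fin n × Fin n) ℂ | ∃ A : Matrix (Fin (n + 1)) (Fin (n + 1)) (MvPolynomial (Fin n × Fin n) ℂ), (∀ i j, (A i j).totalDegree ≤ 1) ∧ MvPolynomial.homogeneousComponent n A.det = g})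

/-- item stmt-ValiantsHypothesis-5761 · crux · rank 4 · open · by planner
why it might fail: no invariant below degree n² (Howe; BI17 Thm 3.14); the degree-n² invariant is nonzero at BOTH per_4 and det_4 (BI17 §3.3), and its nonvanishing at per_n is an open Alon–Tarsi-type problem; generic separating-degree bounds (Derksen) are exponential in dim SL_(n²).
sources: BurgisserIkenmeyer2017, Kumar2015, BurgisserHuttenhainIkenmeyer2017, Glynn2010, DerksenKemper2015
[crux] bottom rung with degree control (the mechanism's first test): there are c and n₀ such that
for n ≥ n₀ an SL_{n²}-invariant F of total degree ≤ n^c vanishes on D_n(n) = End·det_n (equivalently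
F(det_n) = 0 for homogeneous F) but F(per_n) ≠ 0. Existence without the degree bound follows from
GIT (per_n ∉ GL·det_n-bar, both polystable); the content is that tableau invariants P_T of
polynomial degree already separate, i.e. the signed admissible-table counts P_T(per_n), P_T(det_n)
(BI17 Prop 3.28-type) can be controlled. [difficulty: L] -/
@[route_item "route-ValiantsHypothesis-UnpaddedGIT", crux]
def PolyDegreeSeparationFromDet : Prop :=
  ∃ c n₀ : ℕ, ∀ n ≥ n₀, ∃ F : MvPolynomial ((Fin n × Fin n) →₀ ℕ) ℂ, F.totalDegree ≤ n ^ c ∧ (∀ (g : Matrix.SpecialLinearGroup (Fin n × Fin n) ℂ) (f : MvPolynomial (Fin n × Fin n) ℂ), f.IsHomogeneous n → MvPolynomial.aeval (Literature.Computability.AlgebraicComplexity.coeffVec (Literature.Computability.AlgebraicComplexity.linSubst (Fin n × Fin n) ℂ (g : Matrix (Fin n × Fin n) (Fin n × Fin n) ℂ) f)) F = MvPolynomial.aeval (Literature.Computability.AlgebraicComplexity.coeffVec f) F) ∧ (∀ A : Matrix (Fin n) (Fin n) (MvPolynomial (Fin n × Fin n) ℂ), (∀ i j, (A i j).totalDegree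 ≤ 1) → MvPolynomial.aeval (Literature.Computability.AlgebraicComplexity.coeffVec (MvPolynomial.homogeneousComponent n A.det)) F = 0) ∧ MvPolynomial.aeval (Literature.Computability.AlgebraicComplexity.coeffVec (Literature.Computability.AlgebraicComplexity.perPoly (Fin n) ℂ)) F ≠ 0

/-- item stmt-ValiantsHypothesis-5762 · support · rank 9 · closed · proved by Summit.ValiantsHypothesis.ValiantsHypothesis.Theorems.paddedToPencil_proof @ 9a23462d1ba5 (prover) · by planner
sources: MulmuleySohoni2001, BurgisserIkenmeyerPanova2019, Landsberg2017
[support] model comparison (links X to route GCTMult): if the padded permanent X₀₀^(m−n)per_n lies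
in the orbit closure of det_m (HasBorderDetRepr, n ≤ m) then per_n lies in the Zariski closure of
D_m(n) — restrict det_m(g·X) to the n²+1 variables, set X₀₀ = 1, take the degree-n component (a
linear, hence Zariski-continuous, map on degree-m coefficient vectors). Hence X at (n, m) ⇒
GCTMult.GctThesis at (n, m). [difficulty: M] -/
@[route_item "route-ValiantsHypothesis-UnpaddedGIT", crux]
def PaddedToPencil : Prop :=
  ∀ (n m : ℕ) [NeZero m], n ≤ m → Literature.Computability.AlgebraicComplexity.HasBorderDetRepr ℂ n m → Literature.Computability.AlgebraicComplexity.coeffVec (Literature.Computability.AlgebraicComplexity.perPoly (Fin n) ℂ) ∈ Literature.Computability.AlgebraicComplexity.zariskiClosure (Literature.Computability.AlgebraicComplexity.coeffVec '' {g : MvPolynomial (Fin n × Fin n) ℂ | ∃ A : Matrix (Fin m) (Fin m) (MvPolynomial (Fin n × Fin n) ℂ), (∀ i j, (A i j).totalDegree ≤ 1) ∧ MvPolynomial.homogeneousComponent n A.det = g})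

/-- item stmt-ValiantsHypothesis-5763 · support · rank 9 · closed · proved by Summit.ValiantsHypothesis.ValiantsHypothesis.Theorems.grenetPencil_proof @ 3bd9dfe8a3c4 (prover) · by planner
sources: Grenet2011, Literature.Computability.AlgebraicComplexity.determinantalComplexity_perPoly_le_holds
[support] junk guard (upper side): per_n ∈ D_(2^n − 1)(n) for n ≥ 1, from Grenet's dc(per_n) ≤ 2^n −
1 (tree: determinantalComplexity_perPoly_le_holds, hasDetRepr_determinantalComplexity_holds,
HasDetRepr.mono_holds) and hc_n(per_n) = per_n; shows the target is not junk-true at exponential m.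
[difficulty: provable-now] -/
@[route_item "route-ValiantsHypothesis-UnpaddedGIT", crux]
def GrenetPencil : Prop :=
  ∀ n : ℕ, 1 ≤ n → Literature.Computability.AlgebraicComplexity.perPoly (Fin n) ℂ ∈ {g : MvPolynomial (Fin n × Fin n) ℂ | ∃ A : Matrix (Fin (2 ^ n - 1)) (Fin (2 ^ n - 1)) (MvPolynomial (Fin n × Fin n) ℂ), (∀ i j, (A i j).totalDegree ≤ 1) ∧ MvPolynomial.homogeneousComponent n A.det = g}

/-- item stmt-ValiantsHypothesis-5764 · support · rank 9 · closed · proved by Summit.ValiantsHypothesis.ValiantsHypothesis.Theorems.UnpaddedGIT.quadricSanity_proof @ b33c958d9b6c (prover) · by planner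
sources: BurgisserIkenmeyer2017, Weyl1939
[support] junk guard (lower side, satisfiability of the encoding): for n = 2, m = 1 (D_1(2) = {0})
the discriminant of quaternary quadratic forms is an SL_4-invariant polynomial in the coefficients,
vanishes at 0 and not at the full-rank quadric per_2 = x₀₀x₁₁ + x₀₁x₁₀ (BI17 Rem 3.27). [difficulty:
provable-now] -/
@[route_item "route-ValiantsHypothesis-UnpaddedGIT", crux]
def QuadricSanity : Prop :=
  ∃ F : MvPolynomial ((Fin 2 × Fin 2) →₀ ℕ) ℂ, (∀ (g : Matrix.SpecialLinearGroup (Fin 2 × Fin 2) ℂ) (f : MvPolynomial (Fin 2 × Fin 2) ℂ), f.IsHomogeneous 2 → MvPolynomial.aeval (Literature.Computability.AlgebraicComplexity.coeffVec (Literature.Computability.AlgebraicComplexity.linSubst (Fin 2 × Fin 2) ℂ (g : Matrix (Fin 2 × Fin 2) (Fin 2 × Fin 2) ℂ) f)) F = MvPolynomial.aeval (Literature.Computability.AlgebraicComplexity.coeffVec f) F) ∧ (∀ A : Matrix (Fin 1) (Fin 1) (MvPolynomial (Fin 2 × Fin 2) ℂ), (∀ i j, (A i j).totalDegree ≤ 1)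 → MvPolynomial.aeval (Literature.Computability.AlgebraicComplexity.coeffVec (MvPolynomial.homogeneousComponent 2 A.det)) F = 0) ∧ MvPolynomial.aeval (Literature.Computability.AlgebraicComplexity.coeffVec (Literature.Computability.AlgebraicComplexity.perPoly (Fin 2) ℂ)) F ≠ 0

/-- item stmt-ValiantsHypothesis-5765 · support · rank 9 · closed · proved by Summit.ValiantsHypothesis.ValiantsHypothesis.Theorems.completeness_proof (prover) · by planner
sources: MumfordFogartyKirwan1994, BurgisserIkenmeyer2017, DerksenKemper2015, KempfNess1979
[support] obstructions exist iff the separation holds: with (i) polystability of per_n (the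
SL_{n²}-orbit of per_n is Zariski closed in coefficient space; BI17 Cor 2.9) and (ii) Mumford
separation for SL_{n²} acting on degree-n forms (disjoint Zariski-closed SL-stable subsets are
separated by an invariant taking values 0 and 1) both INLINED AS HYPOTHESES (they are requested as
Literature cite facts), per_n ∉ Zariski-closure(D_m(n)) implies the existence of the invariant F of
the target at (n, m). What remains is bookkeeping: D_m is SL-stable (linear substitution keeps
entries affine and commutes with det and with homogeneous components), closures of stable sets are
stable, the orbit is disjoint from the closure. [difficulty: M] -/
@[route_item "route-ValiantsHypothesis-UnpaddedGIT", crux]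
def Completeness : Prop :=
  ∀ n : ℕ, (∀ v : ((Fin n × Fin n) →₀ ℕ) → ℂ, v ∈ Literature.Computability.AlgebraicComplexity.zariskiClosure (Literature.Computability.AlgebraicComplexity.coeffVec '' {h : MvPolynomial (Fin n × Fin n) ℂ | ∃ g : Matrix.SpecialLinearGroup (Fin n × Fin n) ℂ, h = Literature.Computability.AlgebraicComplexity.linSubst (Fin n × Fin n) ℂ (g : Matrix (Fin n × Fin n) (Fin n × Fin n) ℂ) (Literature.Computability.AlgebraicComplexity.perPoly (Fin n) ℂ)}) → v ∈ Literature.Computability.AlgebraicComplexity.coeffVec '' {h : MvPolynomial (Fin n × Fin n) ℂ | ∃ g : Matrix.SpecialLinearGroup (Fin n × Fin n) ℂ, h = Literature.Computability.AlgebraicComplexity.linSubst (Fin n × Fin n) ℂ (g : Matrix (Fin n × Fin n) (Fin n × Fin n) ℂ) (Literature.Computability.AlgebraicComplexity.perPoly (Fin n) ℂ)}) → (∀ Z₁ Z₂ : Set (((Fin n × Fin n) →₀ ℕ) → ℂ), Literature.Computability.AlgebraicComplexity.zariskiClosure Z₁ = Z₁ → Literature.Computability.AlgebraicComplexity.zariskiClosure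 Z₂ = Z₂ → Z₁ ⊆ Literature.Computability.AlgebraicComplexity.coeffVec '' {f : MvPolynomial (Fin n × Fin n) ℂ | f.IsHomogeneous n} → Z₂ ⊆ Literature.Computability.AlgebraicComplexity.coeffVec '' {f : MvPolynomial (Fin n × Fin n) ℂ | f.IsHomogeneous n} → (∀ (g : Matrix.SpecialLinearGroup (Fin n × Fin n) ℂ) (f : MvPolynomial (Fin n × Fin n) ℂ), Literature.Computability.AlgebraicComplexity.coeffVec f ∈ Z₁ → Literature.Computability.AlgebraicComplexity.coeffVec (Literature.Computability.AlgebraicComplexity.linSubst (Fin n × Fin n) ℂ (g : Matrix (Fin n × Fin n) (Fin n × Fin n) ℂ) f) ∈ Z₁) → (∀ (g : Matrix.SpecialLinearGroup (Fin n × Fin n) ℂ) (f : MvPolynomial (Fin n × Fin n) ℂ), Literature.Computability.AlgebraicComplexity.coeffVec f ∈ Z₂ → Literature.Computability.AlgebraicComplexity.coeffVec (Literature.Computability.AlgebraicComplexity.linSubst (Fin n × Fin n) ℂ (g : Matrix (Fin n × Fin n) (Fin n × Fin n) ℂ) f) ∈ Z₂) → Disjoint Z₁ Z₂ → ∃ F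 : MvPolynomial ((Fin n × Fin n) →₀ ℕ) ℂ, (∀ (g : Matrix.SpecialLinearGroup (Fin n × Fin n) ℂ) (f : MvPolynomial (Fin n × Fin n) ℂ), f.IsHomogeneous n → MvPolynomial.aeval (Literature.Computability.AlgebraicComplexity.coeffVec (Literature.Computability.AlgebraicComplexity.linSubst (Fin n × Fin n) ℂ (g : Matrix (Fin n × Fin n) (Fin n × Fin n) ℂ) f)) F = MvPolynomial.aeval (Literature.Computability.AlgebraicComplexity.coeffVec f) F) ∧ (∀ v ∈ Z₁, MvPolynomial.aeval v F = 0) ∧ (∀ v ∈ Z₂, MvPolynomial.aeval v F = 1)) → ∀ m : ℕ, Literature.Computability.AlgebraicComplexity.coeffVec (Literature.Computability.AlgebraicComplexity.perPoly (Fin n) ℂ) ∉ Literature.Computability.AlgebraicComplexity.zariskiClosure (Literature.Computability.AlgebraicComplexity.coeffVec '' {g : MvPolynomial (Fin n × Fin n) ℂ | ∃ A : Matrix (Fin m) (Fin m) (MvPolynomial (Fin n × Fin n) ℂ), (∀ i j, (A i j).totalDegree ≤ 1) ∧ MvPolynomial.homogeneousComponent n A.det = g}) → ∃ F : MvPolynomial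 ((Fin n × Fin n) →₀ ℕ) ℂ, (∀ (g : Matrix.SpecialLinearGroup (Fin n × Fin n) ℂ) (f : MvPolynomial (Fin n × Fin n) ℂ), f.IsHomogeneous n → MvPolynomial.aeval (Literature.Computability.AlgebraicComplexity.coeffVec (Literature.Computability.AlgebraicComplexity.linSubst (Fin n × Fin n) ℂ (g : Matrix (Fin n × Fin n) (Fin n × Fin n) ℂ) f)) F = MvPolynomial.aeval (Literature.Computability.AlgebraicComplexity.coeffVec f) F) ∧ (∀ A : Matrix (Fin m) (Fin m) (MvPolynomial (Fin n × Fin n) ℂ), (∀ i j, (A i j).totalDegree ≤ 1) → MvPolynomial.aeval (Literature.Computability.AlgebraicComplexity.coeffVec (MvPolynomial.homogeneousComponent n A.det)) F = 0) ∧ MvPolynomial.aeval (Literature.Computability.AlgebraicComplexity.coeffVec (Literature.Computability.AlgebraicComplexity.perPoly (Fin n) ℂ)) F ≠ 0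

/-- item stmt-ValiantsHypothesis-5766 · assembly · rank 1 · closed · proved by Summit.ValiantsHypothesis.ValiantsHypothesis.Theorems.unpaddedGIT_assembly_proof @ 1c1e79020261 (prover) · by planner
sources: BurgisserClausenShokrollahi1997, Burgisser2000, Valiant1979, MignonRessayre2004
[assembly] InvariantSeparationQP → ValiantsHypothesis (facts VP ⇒ dc qp-bounded, attainment of dc,
per ∈ VNP and the renaming bridge are proved tree theorems and are used, not assumed). -/
@[route_item "route-ValiantsHypothesis-UnpaddedGIT", crux]
def Assembly : Prop :=
  InvariantSeparationQP → ValiantsHypothesis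

/-! D-0027 §2.1 — DECIDING THEOREM (planner-authored via `route open/edit --closes-file`; by planner-rrepair-ValiantsHypothesis-UnpaddedGIT-99d66e60-g2-0 2026-08-15T17:01:04Z):
its hypotheses are this route's items and its conclusion the sub-problem Statement (glue_lint), and it elaborates with this file. -/

@[closes "route-ValiantsHypothesis-UnpaddedGIT"] theorem closes : InvariantSeparationQP → InvariantSeparationPoly → PerNotInPencilNPlusOne → PolyDegreeSeparationFromDet → PaddedToPencil → GrenetPencil → QuadricSanity → Completeness → Assembly → _root_.ValiantsHypothesis := fun h_InvariantSeparationQP h_InvariantSeparationPoly h_PerNotInPencilNPlusOne h_PolyDegreeSeparationFromDet h_PaddedToPencil h_GrenetPencil h_QuadricSanity h_Completeness h_Assembly => h_Assembly h_InvariantSeparationQP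

end Summit.ValiantsHypothesis.ValiantsHypothesis.Theses.UnpaddedGIT
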